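import Mathlib
import Literature.Computability.AlgebraicComplexity.StandardFamilies
import Literature.AlgebraicGeometry.Resolution.Dehomogenization
import Literature.AlgebraicGeometry.DeterminantalHypersurfaces.KernerVinnikovSaturation
import Summits.ValiantsHypothesis.ValiantsHypothesis.Theorems.BorderApolarityToricWitnessObstructionQPStubPencilOfNormalForm

/-!
# Border apolarity, crux `ToricWitnessObstructionQP` — the CHART of a torus leading form

Route `ValiantsHypothesis/BorderApolarity`, crux item `stmt-ValiantsHypothesis-14753`, line `Sketch`
(lead c6).  The residual objects of the line are TORUS LEADING FORMS `TLF n m` (disprover's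
`Cruxes/…/Disproof.lean` §4, = conclusion of the landed `stub_pencilOfNormalForm`): data
`e' a₀ : ℕ`, `γ : Fin n → Fin n → ℕ`, `G₀ : ℂ^{m×m}`, `G : Fin n → Fin n → ℂ^{m×m}` with

  `deg_s det (s^{a₀} G₀ + Σ_{ij} s^{γ i j} X_{ij} G_{ij}) ≤ e'`,
  `[s^{e'}] det (s^{a₀} G₀ + Σ_{ij} s^{γ i j} X_{ij} G_{ij}) = per_n`.

This file proves the CHART LEMMA (regimes.md §1, lead c5, in homogeneous form): over the ten
variables `Option (Fin n × Fin n)` (`none` = the homogenising variable `x₀₀`, `some (i,j)` = `X_{ij}`)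
let `F := det M̂`, `M̂_{ab} := G₀ab • X none + Σ_{ij} G i j a b • X (some (i,j))` (a form of degree
`m`) and `ŵ none := a₀`, `ŵ (some (i,j)) := γ i j`.  Then

* `det_pencil_eq_aeval_chart`: the pencil determinant is the image of `F` under the torus
  generating map `X_v ↦ s^{ŵ v} · spec v` (`spec none = 1`, `spec (some p) = X p`), so
  (`coeff_pencil_eq_aeval_component`) `[s^j] det(pencil) = spec (ŵ-weight-j component of F)`;
* `aeval_spec_eq_rename_dehomogenize`: `spec` is the dehomogenisation `x₀₀ ↦ 1` followed by a
  bijective renaming, hence injective on forms of a fixed degree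
  (`Literature.AlgebraicGeometry.Resolution.dehomogenize_ne_zero_of_isHomogeneous`);
* `tlf_chart`: the TLF conditions say exactly that every monomial of `F` has `ŵ`-weight `≤ e'`
  and that the `ŵ`-weight-`e'` component of `F` is the homogenised permanent
  `X none ^ (m - n) * rename some per_n` — i.e. the padded permanent is the TOP weight component of
  an honest linear determinant of size `m` (the form used by `jetRegime_seven_le` and by the
  membership argument TLF ⇒ border determinantal expression).

All statements avoid auxiliary definitions (functions are passed with their defining equations).
-/

open MvPolynomial
open scoped BigOperators Matrix Polynomial

-- the mandated summit-side namespace repeats a component by design (single-problem summit)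
set_option linter.dupNamespace false

namespace Summit.ValiantsHypothesis.ValiantsHypothesis.Theorems.BorderApolarityToricWitnessObstructionQP

noncomputable section

namespace TLFChart

open Literature.Computability.AlgebraicComplexity
open Literature.AlgebraicGeometry.Resolution (dehomogenize killVar killVar_self killVar_of_ne
  dehomogenize_ne_zero_of_isHomogeneous)
open Literature.AlgebraicGeometry.DeterminantalHypersurfaces (isHomogeneous_det_of_linear)

variable {n m : ℕ}

/-- **The pencil is the torus image of the chart determinant.**  With
`M̂_{ab} = G₀ab • X none + Σ G i j a b • X (some (i,j))` and the algebra map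
`T : X_v ↦ s^{ŵ v} · spec v`, `det (T M̂) = T (det M̂)` and `T M̂` is the TLF pencil. [folklore] -/
theorem det_pencil_eq_aeval_chart (a₀ : ℕ) (γ : Fin n → Fin n → ℕ)
    (G₀ : Matrix (Fin m) (Fin m) ℂ) (G : Fin n → Fin n → Matrix (Fin m) (Fin m) ℂ) :
    (Matrix.of fun a b : Fin m => Polynomial.monomial a₀ (C (G₀ a b)) +
        ∑ i : Fin n, ∑ j : Fin n, Polynomial.monomial (γ i j) (C (G i j a b) * X (i, j)) :
          Matrix (Fin m) (Fin m) (Polynomial (MvPolynomial (Fin n × Fin n) ℂ))).det =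
      aeval (fun v : Option (Fin n × Fin n) =>
          Polynomial.monomial (v.elim a₀ fun p => γ p.1 p.2)
            (v.elim (1 : MvPolynomial (Fin n × Fin n) ℂ) X))
        (Matrix.of fun a b : Fin m => G₀ a b • X none +
          ∑ i : Fin n, ∑ j : Fin n, G i j a b • X (some (i, j)) :
            Matrix (Fin m) (Fin m) (MvPolynomial (Option (Fin n × Fin n)) ℂ)).det := by
  rw [AlgHom.map_det]
  congr 1
  refine Matrix.ext fun a b => ?_
  simp only [AlgHom.mapMatrix_apply, Matrix.map_apply, Matrix.of_apply, map_add, map_sum,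
    map_smul, aeval_X, Option.elim_none, Option.elim_some, Polynomial.smul_monomial]
  congr 1
  · rw [smul_eq_C_mul, mul_one]
  · refine Finset.sum_congr rfl fun i _ => Finset.sum_congr rfl fun j _ => ?_
    rw [smul_eq_C_mul]

/-- **`s`-coefficients of the pencil = specialised weight components of the chart determinant.**
[folklore] -/
theorem coeff_pencil_eq_aeval_component (a₀ : ℕ) (γ : Fin n → Fin n → ℕ)
    (G₀ : Matrix (Fin m) (Fin m) ℂ) (G : Fin n → Fin n → Matrix (Fin m) (Fin m) ℂ) (j : ℕ) :
    (Matrix.of fun a b : Fin m => Polynomial.monomial a₀ (C (G₀ a b)) +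
        ∑ i : Fin n, ∑ j : Fin n, Polynomial.monomial (γ i j) (C (G i j a b) * X (i, j)) :
          Matrix (Fin m) (Fin m) (Polynomial (MvPolynomial (Fin n × Fin n) ℂ))).det.coeff j =
      aeval (fun v : Option (Fin n × Fin n) => v.elim (1 : MvPolynomial (Fin n × Fin n) ℂ) X)
        (weightedHomogeneousComponent (fun v : Option (Fin n × Fin n) => v.elim a₀ fun p => γ p.1 p.2) j
          (Matrix.of fun a b : Fin m => G₀ a b • X none +
            ∑ i : Fin n, ∑ j : Fin n, G i j a b • X (some (i, j)) :
              Matrix (Fin m) (Fin m) (MvPolynomial (Option (Fin n × Fin n)) ℂ)).det) := by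
  rw [det_pencil_eq_aeval_chart, coeff_aeval_monomial_pow_weight]

/-- **The specialisation `x₀₀ ↦ 1` is dehomogenisation followed by a bijective renaming.**
[folklore] -/
theorem aeval_spec_eq_rename_dehomogenize :
    (aeval (fun v : Option (Fin n × Fin n) => v.elim (1 : MvPolynomial (Fin n × Fin n) ℂ) X) :
        MvPolynomial (Option (Fin n × Fin n)) ℂ →ₐ[ℂ] MvPolynomial (Fin n × Fin n) ℂ) =
      (rename fun q : {v : Option (Fin n × Fin n) // v ≠ none} =>
          q.1.get (Option.ne_none_iff_isSome.mp q.2)).comp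
        (dehomogenize (R := ℂ) (none : Option (Fin n × Fin n))) := by
  refine MvPolynomial.algHom_ext fun v => ?_
  cases v with
  | none =>
    rw [aeval_X, Option.elim_none, AlgHom.comp_apply]
    change _ = rename _ (aeval (killVar (R := ℂ) (none : Option (Fin n × Fin n))) (X none))
    rw [aeval_X, killVar_self, map_one]
  | some p =>
    rw [aeval_X, Option.elim_some, AlgHom.comp_apply]
    change _ = rename _ (aeval (killVar (R := ℂ) (none : Option (Fin n × Fin n))) (X (some p)))
    rw [aeval_X, killVar_of_ne _ (Option.some_ne_none p), rename_X]
    simp only [Option.get_some]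

/-- The renaming `{v // v ≠ none} → Fin n × Fin n`, `v ↦ v.get`, is injective. [folklore] -/
theorem get_injective :
    Function.Injective fun q : {v : Option (Fin n × Fin n) // v ≠ none} =>
      q.1.get (Option.ne_none_iff_isSome.mp q.2) := by
  intro q₁ q₂ h
  apply Subtype.ext
  simp only at h
  rw [← Option.some_get (Option.ne_none_iff_isSome.mp q₁.2),
    ← Option.some_get (Option.ne_none_iff_isSome.mp q₂.2), h]

/-- **The specialisation is injective on forms**: a form of degree `d` killed by `x₀₀ ↦ 1` is `0`.
[folklore] -/
theorem eq_zero_of_aeval_spec_eq_zero {F : MvPolynomial (Option (Fin n × Fin n)) ℂ} {d : ℕ}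
    (hF : F.IsHomogeneous d)
    (h : aeval (fun v : Option (Fin n × Fin n) => v.elim (1 : MvPolynomial (Fin n × Fin n) ℂ) X)
      F = 0) : F = 0 := by
  classical
  by_contra hne
  have h1 := dehomogenize_ne_zero_of_isHomogeneous (R := ℂ) (none : Option (Fin n × Fin n)) hF hne
  apply h1
  rw [aeval_spec_eq_rename_dehomogenize, AlgHom.comp_apply] at h
  exact rename_injective _ get_injective (by rw [h, map_zero])

/-- Scalar multiples of forms are forms. [folklore] -/
theorem isHomogeneous_smul {σ : Type*} {φ : MvPolynomial σ ℂ} {d : ℕ}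
    (hφ : φ.IsHomogeneous d) (c : ℂ) : (c • φ).IsHomogeneous d := by
  rw [smul_eq_C_mul]
  simpa using (isHomogeneous_C σ c).mul hφ

/-- The chart determinant is a form of degree `m`. [folklore] -/
theorem chartDet_isHomogeneous (G₀ : Matrix (Fin m) (Fin m) ℂ)
    (G : Fin n → Fin n → Matrix (Fin m) (Fin m) ℂ) :
    (Matrix.of fun a b : Fin m => G₀ a b • X none +
        ∑ i : Fin n, ∑ j : Fin n, G i j a b • X (some (i, j)) :
          Matrix (Fin m) (Fin m) (MvPolynomial (Option (Fin n × Fin n)) ℂ)).det.IsHomogeneous m := by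
  have h := isHomogeneous_det_of_linear
    (X := (Matrix.of fun a b : Fin m => G₀ a b • X none +
        ∑ i : Fin n, ∑ j : Fin n, G i j a b • X (some (i, j)) :
          Matrix (Fin m) (Fin m) (MvPolynomial (Option (Fin n × Fin n)) ℂ))) (fun a b => ?_)
  · simpa using h
  · simp only [Matrix.of_apply]
    refine IsHomogeneous.add (isHomogeneous_smul (isHomogeneous_X ℂ _) _) ?_
    refine IsHomogeneous.sum _ _ _ fun i _ => IsHomogeneous.sum _ _ _ fun j _ => ?_
    exact isHomogeneous_smul (isHomogeneous_X ℂ _) _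

/-- A weighted-homogeneous component of a form of degree `d` is a form of degree `d`.
[folklore] -/
theorem isHomogeneous_weightedHomogeneousComponent {σ : Type*} (w : σ → ℕ) (j : ℕ)
    {F : MvPolynomial σ ℂ} {d : ℕ} (hF : F.IsHomogeneous d) :
    (weightedHomogeneousComponent w j F).IsHomogeneous d := by
  classical
  intro e he
  rw [coeff_weightedHomogeneousComponent] at he
  split_ifs at he with h
  · exact hF he
  · exact absurd rfl he

/-- The specialisation of the homogenised permanent is the permanent. [folklore] -/
theorem aeval_spec_X_pow_mul_rename_perPoly (k : ℕ) :
    aeval (fun v : Option (Fin n × Fin n) => v.elim (1 : MvPolynomial (Fin n × Fin n) ℂ) X)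
        (X none ^ k * rename some (perPoly (Fin n) ℂ)) = perPoly (Fin n) ℂ := by
  rw [map_mul, map_pow, aeval_X, Option.elim_none, one_pow, one_mul, aeval_rename]
  have h : ((fun v : Option (Fin n × Fin n) => v.elim (1 : MvPolynomial (Fin n × Fin n) ℂ) X) ∘
      some) = X := by
    funext p
    simp
  rw [h, aeval_X_left, AlgHom.id_apply]

/-- The homogenised permanent `X none ^ (m - n) * rename some per_n` is a form of degree `m`
(for `n ≤ m`). [folklore] -/
theorem isHomogeneous_X_pow_mul_rename_perPoly (hnm : n ≤ m) :
    (X none ^ (m - n) * rename some (perPoly (Fin n) ℂ) :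
      MvPolynomial (Option (Fin n × Fin n)) ℂ).IsHomogeneous m := by
  have hper : (perPoly (Fin n) ℂ).IsHomogeneous n := by
    simpa using (perPoly_isHomogeneous (n := Fin n) (k := ℂ))
  have h1 : ((X none : MvPolynomial (Option (Fin n × Fin n)) ℂ) ^ (m - n)).IsHomogeneous (m - n) := by
    simpa using (isHomogeneous_X ℂ (none : Option (Fin n × Fin n))).pow (m - n)
  have h2 : (rename some (perPoly (Fin n) ℂ) :
      MvPolynomial (Option (Fin n × Fin n)) ℂ).IsHomogeneous n := hper.rename_isHomogeneous
  have := h1.mul h2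
  rwa [Nat.sub_add_cancel hnm] at this

/-- **THE CHART LEMMA.**  A torus leading form datum of size `m` for `per_n` (`n ≤ m`) makes the
chart determinant `F = det M̂` a form all of whose monomials have `ŵ`-weight `≤ e'` and whose
`ŵ`-weight-`e'` component is the homogenised permanent `X none ^ (m - n) * rename some per_n`:
the padded permanent is the TOP torus-weight component of an honest linear determinant of size
`m`. (regimes.md §1, Lemma 1.1, homogeneous form.) [folklore] -/
theorem chart (hnm : n ≤ m) (e' a₀ : ℕ) (γ : Fin n → Fin n → ℕ)
    (G₀ : Matrix (Fin m) (Fin m) ℂ) (G : Fin n → Fin n → Matrix (Fin m) (Fin m) ℂ)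
    (hdeg : (Matrix.of fun a b : Fin m => Polynomial.monomial a₀ (C (G₀ a b)) +
        ∑ i : Fin n, ∑ j : Fin n, Polynomial.monomial (γ i j) (C (G i j a b) * X (i, j)) :
          Matrix (Fin m) (Fin m) (Polynomial (MvPolynomial (Fin n × Fin n) ℂ))).det.natDegree ≤ e')
    (hcoeff : (Matrix.of fun a b : Fin m => Polynomial.monomial a₀ (C (G₀ a b)) +
        ∑ i : Fin n, ∑ j : Fin n, Polynomial.monomial (γ i j) (C (G i j a b) * X (i, j)) :
          Matrix (Fin m) (Fin m) (Polynomial (MvPolynomial (Fin n × Fin n) ℂ))).det.coeff e' =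
        perPoly (Fin n) ℂ)
    (F : MvPolynomial (Option (Fin n × Fin n)) ℂ)
    (hF : F = (Matrix.of fun a b : Fin m => G₀ a b • X none +
        ∑ i : Fin n, ∑ j : Fin n, G i j a b • X (some (i, j)) :
          Matrix (Fin m) (Fin m) (MvPolynomial (Option (Fin n × Fin n)) ℂ)).det)
    (ŵ : Option (Fin n × Fin n) → ℕ) (hŵ : ŵ = fun v => v.elim a₀ fun p => γ p.1 p.2) :
    (∀ j, e' < j → weightedHomogeneousComponent ŵ j F = 0) ∧
    (∀ d ∈ F.support, Finsupp.weight ŵ d ≤ e') ∧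
    weightedHomogeneousComponent ŵ e' F = X none ^ (m - n) * rename some (perPoly (Fin n) ℂ) := by
  classical
  have hFhom : F.IsHomogeneous m := by rw [hF]; exact chartDet_isHomogeneous G₀ G
  -- the `s`-coefficients of the pencil are the specialised components of `F`
  have hcoef : ∀ j, (Matrix.of fun a b : Fin m => Polynomial.monomial a₀ (C (G₀ a b)) +
        ∑ i : Fin n, ∑ j : Fin n, Polynomial.monomial (γ i j) (C (G i j a b) * X (i, j)) :
          Matrix (Fin m) (Fin m) (Polynomial (MvPolynomial (Fin n × Fin n) ℂ))).det.coeff j =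
      aeval (fun v : Option (Fin n × Fin n) => v.elim (1 : MvPolynomial (Fin n × Fin n) ℂ) X)
        (weightedHomogeneousComponent ŵ j F) := by
    intro j
    rw [hF, hŵ]
    exact coeff_pencil_eq_aeval_component a₀ γ G₀ G j
  -- (i) no component above `e'`
  have hi : ∀ j, e' < j → weightedHomogeneousComponent ŵ j F = 0 := by
    intro j hj
    refine eq_zero_of_aeval_spec_eq_zero (isHomogeneous_weightedHomogeneousComponent ŵ j hFhom) ?_
    rw [← hcoef j]
    exact Polynomial.coeff_eq_zero_of_natDegree_lt (lt_of_le_of_lt hdeg hj)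
  refine ⟨hi, ?_, ?_⟩
  · -- (i') every monomial has weight `≤ e'`
    intro d hd
    by_contra hlt
    rw [not_le] at hlt
    have h0 : coeff d (weightedHomogeneousComponent ŵ (Finsupp.weight ŵ d) F) = 0 := by
      rw [hi _ hlt, coeff_zero]
    rw [coeff_weightedHomogeneousComponent, if_pos rfl] at h0
    exact (mem_support_iff.mp hd) h0
  · -- (ii) the component of weight `e'` is the homogenised permanent
    have hhom₁ : (weightedHomogeneousComponent ŵ e' F).IsHomogeneous m :=
      isHomogeneous_weightedHomogeneousComponent ŵ e' hFhom
    have hhom₂ := isHomogeneous_X_pow_mul_rename_perPoly (n := n) (m := m) hnm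
    have hsub := hhom₁.sub hhom₂
    have h0 := eq_zero_of_aeval_spec_eq_zero hsub (by
      rw [map_sub, ← hcoef e', hcoeff, aeval_spec_X_pow_mul_rename_perPoly, sub_self])
    exact sub_eq_zero.mp h0

end TLFChart

open Literature.Computability.AlgebraicComplexity in
/-- **THE CHART LEMMA** (registered helper form of `TLFChart.chart`): a torus leading form datum
`(e', a₀, γ, G₀, G)` of size `m` for `per_n`, `n ≤ m` — `deg_s det(pencil) ≤ e'` and
`[s^{e'}] det(pencil) = per_n` — makes the chart determinant `F = det M̂` over the variables
`Option (Fin n × Fin n)` a form with all `ŵ`-weights `≤ e'`, no `ŵ`-component above `e'`, and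
`ŵ`-component of weight `e'` equal to the homogenised permanent `X none ^ (m - n) * rename some per_n`
(`ŵ none = a₀`, `ŵ (some (i,j)) = γ i j`). [folklore] -/
theorem tlf_chart : ∀ {n m : ℕ}, n ≤ m → ∀ (e' a₀ : ℕ) (γ : Fin n → Fin n → ℕ) (G₀ : Matrix (Fin m) (Fin m) ℂ) (G : Fin n → Fin n → Matrix (Fin m) (Fin m) ℂ), (Matrix.of fun a b : Fin m => Polynomial.monomial a₀ (MvPolynomial.C (G₀ a b)) + ∑ i : Fin n, ∑ j : Fin n, Polynomial.monomial (γ i j) (MvPolynomial.C (G i j a b) * MvPolynomial.X (i, j)) : Matrix (Fin m) (Fin m) (Polynomial (MvPolynomial (Fin n × Fin n) ℂ))).det.natDegree ≤ e' → (Matrix.of fun a b : Fin m => Polynomial.monomial a₀ (MvPolynomial.C (G₀ a b)) + ∑ i : Fin n, ∑ j : Fin n, Polynomial.monomial (γ i j) (MvPolynomial.C (G i j a b) * MvPolynomial.X (i, j)) : Matrix (Fin m) (Fin m) (Polynomial (MvPolynomial (Fin n × Fin n) ℂ))).det.coeff e' = Literature.Computability.AlgebraicComplexity.perPoly (Fin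 n) ℂ → ∀ (F : MvPolynomial (Option (Fin n × Fin n)) ℂ), F = (Matrix.of fun a b : Fin m => G₀ a b • MvPolynomial.X none + ∑ i : Fin n, ∑ j : Fin n, G i j a b • MvPolynomial.X (some (i, j)) : Matrix (Fin m) (Fin m) (MvPolynomial (Option (Fin n × Fin n)) ℂ)).det → ∀ (ŵ : Option (Fin n × Fin n) → ℕ), (ŵ = fun v => v.elim a₀ fun p => γ p.1 p.2) → (∀ j, e' < j → MvPolynomial.weightedHomogeneousComponent ŵ j F = 0) ∧ (∀ d ∈ F.support, Finsupp.weight ŵ d ≤ e') ∧ MvPolynomial.weightedHomogeneousComponent ŵ e' F = MvPolynomial.X none ^ (m - n) * MvPolynomial.rename some (Literature.Computability.AlgebraicComplexity.perPoly (Fin n) ℂ) :=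
  fun hnm e' a₀ γ G₀ G hdeg hcoeff F hF ŵ hŵ => TLFChart.chart hnm e' a₀ γ G₀ G hdeg hcoeff F hF ŵ hŵ

end

end Summit.ValiantsHypothesis.ValiantsHypothesis.Theorems.BorderApolarityToricWitnessObstructionQP
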